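import Summits.ResolutionOfSingularities.ResolutionOfSingularities.Theorems.EquisingularLiftEquisingularLiftNatTwoStepChain
import Summits.ResolutionOfSingularities.ResolutionOfSingularities.Theorems.EquisingularLiftEquisingularLiftNatIsoHypPointOfPoints
import HarnessLib

/-!
# [OURS] ★★★ FINITELY MANY ONE-STEP OR TWO-STEP SINGULAR POINTS, IN ANY POSITION ⟹ the lead's hypothesis #7 `IsoHypPoint` (= `PointResolvable`)
# (cruxes `Theses.EquisingularLift.EquisingularLiftNat` / `…NatThree`, stmt-ResolutionOfSingularities-20038 / -20148)

[OURS · leafhand-res-equisingularlift-10 g1, 2026-08-31; cell `pub/decomp-res`] AI-produced, weaker than expert review; NOT a statement of any manuscript;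
nothing here proves resolution of singularities in positive characteristic.  DEF-FREE helper; no `sorry`; standard axioms; ZERO named hypotheses.

The depth-2 extension of ✓ `isoHypPoint_of_oneStepPoints` (p829346), built on ✓ `PointChain.chain_of_twoStepPoints` (p830907):

* `PointChain.twoStepAt_of_iso` — the two-step property transports along an isomorphism (✓ `twoStepAt_of_isIso_morphismRestrict` with `U = ⊤`);
* ★★★ `isoHypPoint_of_twoStepPoints` — **`k = k̄`, `H` integral, `ι : H ↪ ℙⁿ_k` a closed immersion; the non-regular points of `H` form a finite set
  `S₁ ∪ S₂` of points with closed images, the points of `S₁` ONE-STEP («every blow-up of `H` at the reduced point is regular over it») and the points of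
  `S₂` TWO-STEP («… regular over it except at finitely many closed one-step points»); a point `ξ` off `S₁ ∪ S₂` ⟹ `IsoHypPoint k n H ι`.**
  Typical members of `S₂`: `A₃`, `A₄`, `D₄` surface points (one point blow-up leaves `A₁` / `A₂` / `3A₁`), once their charts are verified.

Honest label: closes no registered stub (the registered isolated residual carries `¬ IsoHypPoint`; this certifies further `H` it excludes).

References: [StacksProject, Tags 080E, 02OS]; [Hartshorne1977, II Ex. 7.12]; [GortzWedhorn2020, Prop. 13.91] — through the cited tree files.
-/

set_option linter.dupNamespace false -- mandated namespace `Summit.<Summit>.<Problem>` of this single-conjunct summit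

noncomputable section

open CategoryTheory CategoryTheory.Limits AlgebraicGeometry TopologicalSpace
open Literature.AlgebraicGeometry.Resolution Literature.AlgebraicGeometry.Motives
open AlgebraicGeometry.Scheme.IdealSheafData

namespace Summit.ResolutionOfSingularities.ResolutionOfSingularities.Cruxes.EquisingularLiftNat.Sections

namespace PointChain

universe u

/-- **The two-step property transports along an isomorphism** (✓ `twoStepAt_of_isIso_morphismRestrict` for `e.inv`, an isomorphism over `⊤`). [folklore] -/
theorem twoStepAt_of_iso {Γ Γ' : Scheme.{u}} (e : Γ ≅ Γ') {y : Γ} (hy : IsClosed ({y} : Set Γ))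
    (htwo : ∀ (B : Scheme.{u}) (π : B ⟶ Γ), IsBlowup π (vanishingIdeal ⟨{y}, hy⟩) →
      ∃ S' : Finset B, (∀ b : B, π b = y → b ∉ S' → IsRegularLocalRing (B.presheaf.stalk b)) ∧
        ∀ b ∈ S', π b = y ∧ ∃ hb : IsClosed ({b} : Set B), ∀ (B' : Scheme.{u}) (π' : B' ⟶ B),
          IsBlowup π' (vanishingIdeal ⟨{b}, hb⟩) → ∀ b' : B', π' b' = b → IsRegularLocalRing (B'.presheaf.stalk b'))
    (hy' : IsClosed ({e.hom y} : Set Γ')) :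
    ∀ (Z : Scheme.{u}) (τ : Z ⟶ Γ'), IsBlowup τ (vanishingIdeal ⟨{e.hom y}, hy'⟩) →
      ∃ S' : Finset Z, (∀ z : Z, τ z = e.hom y → z ∉ S' → IsRegularLocalRing (Z.presheaf.stalk z)) ∧
        ∀ z ∈ S', τ z = e.hom y ∧ ∃ hz : IsClosed ({z} : Set Z), ∀ (Z' : Scheme.{u}) (τ' : Z' ⟶ Z),
          IsBlowup τ' (vanishingIdeal ⟨{z}, hz⟩) → ∀ z' : Z', τ' z' = z → IsRegularLocalRing (Z'.presheaf.stalk z') := by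
  have hyy : e.inv (e.hom y) = y := by change (e.hom ≫ e.inv) y = y; rw [e.hom_inv_id]; rfl
  haveI : IsIso (e.inv ∣_ (⊤ : Γ.Opens)) := inferInstance
  exact twoStepAt_of_isIso_morphismRestrict e.inv ⊤ (Set.mem_univ y) hy htwo hyy hy'

end PointChain

/-- ★★★ **FINITELY MANY ONE-STEP OR TWO-STEP SINGULAR POINTS, IN ANY POSITION ⟹ `IsoHypPoint`** (the lead's hypothesis #7 = `PointResolvable`).
`k` algebraically closed, `H` integral, `ι : H ↪ ℙⁿ_k` a closed immersion; `S₁`, `S₂` finite sets of points of `H` with closed images such that `H` is regular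
exactly off `S₁ ∪ S₂`, every `x ∈ S₁` ONE-STEP and every `x ∈ S₂` TWO-STEP in the intrinsic sense; `ξ ∈ H` off `S₁ ∪ S₂`.  Then `IsoHypPoint k n H ι`: the
downstairs chain blows up the two-step points first (each leaving finitely many new one-step points), then the one-step points
(✓ `PointChain.chain_of_twoStepPoints`). [OURS] [cite: StacksProject, Tag 080E] [cite: Hartshorne1977, II Ex. 7.12] -/
theorem isoHypPoint_of_twoStepPoints (k : Type) [Field k] [IsAlgClosed k] (n : ℕ) (H : Scheme.{0})
    (ι : H ⟶ (projectiveSpace n k).left) [IsClosedImmersion ι] [IsIntegral H]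
    (S₁ S₂ : Finset H)
    (hcl : ∀ x, x ∈ S₁ ∨ x ∈ S₂ → IsClosed ({ι x} : Set (projectiveSpace n k).left))
    (hsing : ∀ x, x ∈ S₁ ∨ x ∈ S₂ → ¬ IsRegularLocalRing (H.presheaf.stalk x))
    (hreg : ∀ x : H, x ∉ S₁ → x ∉ S₂ → IsRegularLocalRing (H.presheaf.stalk x))
    (hone : ∀ x ∈ S₁, ∀ (hx : IsClosed ({x} : Set H)) (Z : Scheme.{0}) (τ : Z ⟶ H),
      IsBlowup τ (vanishingIdeal ⟨{x}, hx⟩) → ∀ z : Z, τ z = x → IsRegularLocalRing (Z.presheaf.stalk z))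
    (htwo : ∀ x ∈ S₂, ∀ (hx : IsClosed ({x} : Set H)) (Z : Scheme.{0}) (τ : Z ⟶ H), IsBlowup τ (vanishingIdeal ⟨{x}, hx⟩) →
      ∃ S' : Finset Z, (∀ z : Z, τ z = x → z ∉ S' → IsRegularLocalRing (Z.presheaf.stalk z)) ∧
        ∀ z ∈ S', τ z = x ∧ ∃ hz : IsClosed ({z} : Set Z), ∀ (Z' : Scheme.{0}) (τ' : Z' ⟶ Z),
          IsBlowup τ' (vanishingIdeal ⟨{z}, hz⟩) → ∀ z' : Z', τ' z' = z → IsRegularLocalRing (Z'.presheaf.stalk z'))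
    (ξ : H) (hξ : ∀ x, x ∈ S₁ ∨ x ∈ S₂ → x ≠ ξ) :
    IsoHypPoint k n H ι := by
  classical
  haveI : IsLocallyNoetherian (projectiveSpace n k).left :=
    AlgebraicGeometry.LocallyOfFiniteType.isLocallyNoetherian (projectiveSpace n k).hom
  have hιinj : Function.Injective ι := ι.isClosedEmbedding.injective
  have hirr : IsIrreducible (Set.range ι) := by
    have h := (IrreducibleSpace.isIrreducible_univ H).image ι ι.continuous.continuousOn
    rwa [Set.image_univ] at h
  -- `H ≅ V(closure ι(H))_red`, compatibly with the embeddings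
  let TD : Closeds (projectiveSpace n k).left := ⟨closure (Set.range ι), isClosed_closure⟩
  have hDker : vanishingIdeal TD = ι.ker := by
    rw [← Scheme.IdealSheafData.map_bot, ← Scheme.nilradical_eq_bot, ← Scheme.IdealSheafData.vanishingIdeal_top,
      Scheme.IdealSheafData.map_vanishingIdeal]
    congr 1
    ext1
    change closure (Set.range ι) = closure (ι '' Set.univ)
    rw [Set.image_univ]
  have hkerD : (vanishingIdeal TD).subschemeι.ker = ι.ker := by
    rw [Scheme.IdealSheafData.ker_subschemeι, hDker]
  let eD : H ⟶ (vanishingIdeal TD).subscheme := IsClosedImmersion.lift _ ι hkerD.le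
  have heD : eD ≫ (vanishingIdeal TD).subschemeι = ι := IsClosedImmersion.lift_fac _ ι hkerD.le
  haveI : IsIso eD := IsClosedImmersion.isIso_lift _ ι hkerD
  have heD_apply : ∀ x : H, (vanishingIdeal TD).subschemeι (eD x) = ι x := fun x => by rw [← Scheme.Hom.comp_apply, heD]
  have heDinj : Function.Injective eD := (Scheme.homeoOfIso (asIso eD)).injective
  have heDsurj : Function.Surjective eD := (Scheme.homeoOfIso (asIso eD)).surjective
  -- transfer the hypotheses to `V(closure ι(H))_red`
  let S₁' : Finset ↥(vanishingIdeal TD).subscheme := S₁.image eD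
  let S₂' : Finset ↥(vanishingIdeal TD).subscheme := S₂.image eD
  have hmemS₁' : ∀ x', x' ∈ S₁' → ∃ x ∈ S₁, eD x = x' := fun x' hx' => by
    obtain ⟨x, hx, h⟩ := Finset.mem_image.mp hx'
    exact ⟨x, hx, h⟩
  have hmemS₂' : ∀ x', x' ∈ S₂' → ∃ x ∈ S₂, eD x = x' := fun x' hx' => by
    obtain ⟨x, hx, h⟩ := Finset.mem_image.mp hx'
    exact ⟨x, hx, h⟩
  have hmemS' : ∀ x', x' ∈ S₁' ∨ x' ∈ S₂' → ∃ x, (x ∈ S₁ ∨ x ∈ S₂) ∧ eD x = x' := by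
    rintro x' (h1 | h2)
    · obtain ⟨x, hx, h⟩ := hmemS₁' x' h1; exact ⟨x, Or.inl hx, h⟩
    · obtain ⟨x, hx, h⟩ := hmemS₂' x' h2; exact ⟨x, Or.inr hx, h⟩
  have hcard : S₂'.card = S₂.card := Finset.card_image_of_injective _ heDinj
  have hξC : ι ξ ∈ (TD : Set (projectiveSpace n k).left) := subset_closure ⟨ξ, rfl⟩
  have hξS : ∀ x', x' ∈ S₁' ∨ x' ∈ S₂' → ((vanishingIdeal TD).subschemeι x' : (projectiveSpace n k).left) ≠ ι ξ := by
    intro x' hx' h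
    obtain ⟨x, hxS, rfl⟩ := hmemS' x' hx'
    rw [heD_apply] at h
    exact hξ x hxS (hιinj h)
  have hreg' : ∀ x' : ↥(vanishingIdeal TD).subscheme, x' ∉ S₁' → x' ∉ S₂' →
      IsRegularLocalRing (((vanishingIdeal TD).subscheme).presheaf.stalk x') := by
    intro x' hx₁ hx₂
    obtain ⟨x, rfl⟩ := heDsurj x'
    have hxS₁ : x ∉ S₁ := fun h => hx₁ (Finset.mem_image_of_mem eD h)
    have hxS₂ : x ∉ S₂ := fun h => hx₂ (Finset.mem_image_of_mem eD h)
    haveI := hreg x hxS₁ hxS₂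
    exact IsRegularLocalRing.of_ringEquiv (R := H.presheaf.stalk x) (asIso (eD.stalkMap x)).commRingCatIsoToRingEquiv.symm
  have hcl' : ∀ x', x' ∈ S₁' ∨ x' ∈ S₂' →
      IsClosed ({((vanishingIdeal TD).subschemeι x' : (projectiveSpace n k).left)} : Set (projectiveSpace n k).left) := by
    intro x' hx'
    obtain ⟨x, hxS, rfl⟩ := hmemS' x' hx'
    rw [heD_apply]; exact hcl x hxS
  have hsing' : ∀ x', x' ∈ S₁' ∨ x' ∈ S₂' → ¬ IsRegularLocalRing (((vanishingIdeal TD).subscheme).presheaf.stalk x') := by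
    intro x' hx' h
    obtain ⟨x, hxS, rfl⟩ := hmemS' x' hx'
    apply hsing x hxS
    haveI := h
    exact IsRegularLocalRing.of_ringEquiv (R := ((vanishingIdeal TD).subscheme).presheaf.stalk (eD x))
      (asIso (eD.stalkMap x)).commRingCatIsoToRingEquiv
  have hone' : ∀ x' ∈ S₁', ∀ (hx' : IsClosed ({x'} : Set ↥(vanishingIdeal TD).subscheme)) (Z : Scheme.{0})
      (τ : Z ⟶ (vanishingIdeal TD).subscheme), IsBlowup τ (vanishingIdeal ⟨{x'}, hx'⟩) →
      ∀ z : Z, τ z = x' → IsRegularLocalRing (Z.presheaf.stalk z) := by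
    intro x' hx'S hx' Z τ hτ z hz
    obtain ⟨x, hxS, rfl⟩ := hmemS₁' x' hx'S
    have hxcl : IsClosed ({x} : Set H) := PointChain.isClosed_singleton_of_injective ι hιinj (hcl x (Or.inl hxS))
    exact PointChain.oneStepAt_of_iso (asIso eD) hxcl (hone x hxS hxcl) hx' Z τ hτ z hz
  have htwo' : ∀ x' ∈ S₂', ∀ (hx' : IsClosed ({x'} : Set ↥(vanishingIdeal TD).subscheme)) (Z : Scheme.{0})
      (τ : Z ⟶ (vanishingIdeal TD).subscheme), IsBlowup τ (vanishingIdeal ⟨{x'}, hx'⟩) →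
      ∃ S' : Finset Z, (∀ z : Z, τ z = x' → z ∉ S' → IsRegularLocalRing (Z.presheaf.stalk z)) ∧
        ∀ z ∈ S', τ z = x' ∧ ∃ hz : IsClosed ({z} : Set Z), ∀ (Z' : Scheme.{0}) (τ' : Z' ⟶ Z),
          IsBlowup τ' (vanishingIdeal ⟨{z}, hz⟩) → ∀ z' : Z', τ' z' = z → IsRegularLocalRing (Z'.presheaf.stalk z') := by
    intro x' hx'S hx' Z τ hτ
    obtain ⟨x, hxS, rfl⟩ := hmemS₂' x' hx'S
    have hxcl : IsClosed ({x} : Set H) := PointChain.isClosed_singleton_of_injective ι hιinj (hcl x (Or.inr hxS))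
    exact PointChain.twoStepAt_of_iso (asIso eD) hxcl (htwo x hxS hxcl) hx' Z τ hτ
  obtain ⟨F', ρ', T', hF', hreg''⟩ := PointChain.chain_of_twoStepPoints (P := (projectiveSpace n k).left) S₂.card
    (projectiveSpace n k).left (𝟙 _) (Set.range ι) ι.isClosedEmbedding.isClosed_range hirr TD rfl S₁' S₂' hcard (ι ξ) hξC hξS
    hreg' hcl' hsing' hone' htwo'
  exact ⟨F', ρ', T', fun Q h0 hstep => hF' Q hstep h0, hreg''⟩

end Summit.ResolutionOfSingularities.ResolutionOfSingularities.Cruxes.EquisingularLiftNat.Sections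

end
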